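/-
Copyright (c) 2026 the pub-hodgecm-mathlib formalisation cell (harness21).  Prover seat hodgecm-mathlib-LH4-p05 (g2): Track A «(D-RAM) FOUR-FRAME» squad of crux H413
(dealer LH4-plan (g10) WORD #46 «p05 (g2) DEFAULT «=»: (ρ) ROW (3) TYPE-UNIT organ», HOME census v3 §3 of LH4-p05 (g0), brick F1), 2026-09-03.
The √u-TYPE companion of ★ `RamifiedPlaceFixedValuationParity` (LH4-p05 (g0), p855163): parity of orders at a ramified place carrying an anti-fixed UNIT.
-/
import Literature.NumberTheory.LocalFields.RamifiedPlaceFixedValuationParity   -- ★ p855163 (this lineage): §1 `even_log_valued_of_galAdicCompletionMap_eq_self` (fixed ⇒ even order, `|2|`-free); brings ★ `valued_galAdicCompletionMap_sub_lt_one_of_ramified`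
import HarnessLib

/-!
# Valuation parity at a ramified non-split place carrying an anti-fixed UNIT (the wild type `E_w = F_v(√u)`): anti-fixed elements have EVEN order,
# the skew line has no element of order `±1`, and `|2|_w < 1`

Topic `NumberTheory/LocalFields`; namespace `Literature.NumberTheory.LocalFields.RamifiedPlaceAntiFixedUnitParity`.  THEOREMS ONLY (no definition, no instance, no
notation, no named fact, no `sorry`).  Cell `pub/hodgecm-mathlib`, crux H413 = `stmt-HodgeConjecture-24833` (lane `--supports`, count-neutral), Track A «(D-RAM) FOUR-FRAME»,
unit U2H, (ρ) ROW (3) = child (f) «Levi row» (LH4-p05 lineage; dealer LH4-plan (g10) WORD #46): the TYPE-UNIT organ `Φ_H(⟦(t,u)⟧, χ♯) = ν_H(K_H)·J_H(t)·2∕(q+1)` runs on ONE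
root fact about the skew line at such a place — «an anti-fixed element has EVEN order» — exactly as the type-odd organ (★ p855329) ran on ★ p855163 §2 «odd order».  This file is
that root fact and its valuation-currency corollaries; it is the mirror image of ★ `RamifiedPlaceFixedValuationParity` §2 (there: anti-fixed UNIFORMISER ⇒ anti-fixed elements have
ODD order).

THE MATHEMATICS ([SerreLocalFields1979] Ch. III §6, Ch. IV §2; [Jacobowitz1962] §5: the two types of ramified dyadic quadratic extensions).  `E∕F` a quadratic extension of
number fields with non-trivial automorphism `c`, `w ∣ v` a finite place of `E` fixed by `c` (non-split) and RAMIFIED (`e(w|v) ≠ 1`), `σ_w` the induced automorphism of `E_w`,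
and `α ∈ E_w` an ANTI-FIXED UNIT: `σ_w α = −α`, `v_w(α) = 1` (so `E_w = F_v(α)` with `α² ∈ F_v` a unit: the «unit type»; it is wildly ramified, §3).
* §1 `even_log_valued_of_galAdicCompletionMap_eq_neg_of_unit`: an anti-fixed `y ≠ 0` has EVEN order — `y·α` is `σ_w`-fixed, hence of even order (★ p855163 §1, Galois
  descent + `e(w|v) = 2`), and `v_w(yα) = v_w(y)`.  Power currency: `exists_valued_eq_exp_two_mul_of_galAdicCompletionMap_eq_neg_of_unit`.
* §2 valuation-currency corollaries (the three the organ consumes): `valued_le_exp_of_le_exp_add_one_of_unit` (`v_w y ≤ exp(2m+1) ⇒ v_w y ≤ exp(2m)`),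
  `valued_le_one_of_valued_le_exp_one_of_unit` (`v_w y ≤ exp 1 ⇒ v_w y ≤ 1`: the fibre of the `ϖ`-modular level over the torus line is the integral skew line),
  `valued_le_exp_neg_two_of_valued_lt_one_of_unit` (`v_w y < 1 ⇒ v_w y ≤ exp(−2)`: the sub-integral skew line is one `F_v`-uniformiser deep), and the sharpness statement
  `valued_ne_exp_neg_one_of_galAdicCompletionMap_eq_neg_of_unit` (no anti-fixed uniformiser — cf. ★ p855163 `not_exists_uniformizer_galAdicCompletionMap_eq_neg_of_unit`).
* §3 `valued_two_lt_one_of_unit`: such a place is WILD, `|2|_w < 1` (`2α = α − σ_w α` and `σ_w ≡ id (mod 𝔪_w)`, ★ `valued_galAdicCompletionMap_sub_lt_one_of_ramified`).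
* §4 the CM rows (`F = L⁺`, `c` = complex conjugation), the currency of the U2H Levi port.

HONEST LABEL: HC_CM is proved only modulo the 7 printed citations (2 remaining named inputs: hLiu418 = `stmt-HodgeConjecture-24832`, h413 = `stmt-HodgeConjecture-24833`) until
rung 0 closes; this file is unconditional local algebra, asserts nothing printed and freezes no stub text.

## References
* [SerreLocalFields1979] J.-P. Serre, *Local Fields*, GTM 67 (1979): Ch. II §3, Ch. III §6 (ramification in quadratic extensions), Ch. IV §2 Prop. 5.
* [Jacobowitz1962] R. Jacobowitz, *Hermitian forms over local fields*, Amer. J. Math. 84 (1962), §5 (ramified dyadic extensions: the types `F(√u)` ∕ `F(√π)`).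
* [CasselsFrohlichANT1967] J. W. S. Cassels, A. Fröhlich (eds.), *Algebraic Number Theory* (1967), Ch. VII §1.1 (the decomposition group acts on `E_w`; fixed field `F_v`).
-/

set_option autoImplicit false

noncomputable section

open NumberField IsDedekindDomain
open Literature.NumberTheory.Automorphic Literature.NumberTheory.Automorphic.UnitaryGroup
open Literature.NumberTheory.Automorphic.Liu2021.LemD1IndexedNonVacuityRamifiedConverse (valued_galAdicCompletionMap_sub_lt_one_of_ramified)
open Literature.NumberTheory.LocalFields.RamifiedPlaceFixedValuationParity (even_log_valued_of_galAdicCompletionMap_eq_self)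

namespace Literature.NumberTheory.LocalFields.RamifiedPlaceAntiFixedUnitParity

variable {F : Type} (E : Type) [Field F] [NumberField F] [Field E] [NumberField E] [Algebra F E]
  [Algebra.IsQuadraticExtension F E] (c : E ≃ₐ[F] E) {v : HeightOneSpectrum (𝓞 F)}

/-! ## §1 With an anti-fixed unit, anti-fixed elements have even order -/

/-- **ANTI-FIXED NON-ZERO ELEMENTS HAVE EVEN ORDER** at a ramified non-split place carrying an anti-fixed UNIT `α` (`σ_w α = −α`, `v_w α = 1`): for `σ_w y = −y`, `y ≠ 0`,
the product `y·α` is `σ_w`-fixed, so of even order (★ p855163 §1: Galois descent and `e(w|v) = 2`), and `v_w(yα) = v_w(y)`.  The mirror image of ★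
`odd_log_valued_of_galAdicCompletionMap_eq_neg_of_uniformizer`. [cite: SerreLocalFields1979, Ch. III §6; Ch. IV §2 Prop. 5] [cite: Jacobowitz1962, §5] -/
theorem even_log_valued_of_galAdicCompletionMap_eq_neg_of_unit (hc : c ≠ 1) (w : PlacesOver E v) (hw : c • w.1 = w.1)
    (he : v.asIdeal.ramificationIdx' w.1.asIdeal ≠ 1) {α : w.1.adicCompletion E} (hα : Valued.v α = 1)
    (hσα : galAdicCompletionMap (L := E) c hw α = -α) {y : w.1.adicCompletion E} (hy0 : y ≠ 0)
    (hσy : galAdicCompletionMap (L := E) c hw y = -y) : Even (WithZero.log (Valued.v y)) := by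
  have hα0 : α ≠ 0 := fun h => by rw [h, map_zero] at hα; exact zero_ne_one hα
  have hfix : galAdicCompletionMap (L := E) c hw (y * α) = y * α := by rw [map_mul, hσy, hσα, neg_mul_neg]
  have h := even_log_valued_of_galAdicCompletionMap_eq_self E c hc w hw he (mul_ne_zero hy0 hα0) hfix
  rwa [map_mul, hα, mul_one] at h

/-- The same in power currency: an anti-fixed `y ≠ 0` has `v_w(y) = exp(2k)` for some `k ∈ ℤ`. [cite: SerreLocalFields1979, Ch. III §6] [cite: Jacobowitz1962, §5] -/
theorem exists_valued_eq_exp_two_mul_of_galAdicCompletionMap_eq_neg_of_unit (hc : c ≠ 1) (w : PlacesOver E v) (hw : c • w.1 = w.1)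
    (he : v.asIdeal.ramificationIdx' w.1.asIdeal ≠ 1) {α : w.1.adicCompletion E} (hα : Valued.v α = 1)
    (hσα : galAdicCompletionMap (L := E) c hw α = -α) {y : w.1.adicCompletion E} (hy0 : y ≠ 0)
    (hσy : galAdicCompletionMap (L := E) c hw y = -y) : ∃ k : ℤ, Valued.v y = WithZero.exp (2 * k) := by
  obtain ⟨k, hk⟩ := even_log_valued_of_galAdicCompletionMap_eq_neg_of_unit E c hc w hw he hα hσα hy0 hσy
  refine ⟨k, ?_⟩
  have h := WithZero.exp_log (x := Valued.v y) ((Valuation.ne_zero_iff _).2 hy0)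
  rw [← h, hk, two_mul]

/-! ## §2 Valuation-currency corollaries: no order `2m + 1` on the skew line -/

/-- **`v_w y ≤ exp(2m+1) ⇒ v_w y ≤ exp(2m)`** for an anti-fixed `y` at such a place (its order is even or `y = 0`). [cite: SerreLocalFields1979, Ch. IV §2 Prop. 5] [cite: Jacobowitz1962, §5] -/
theorem valued_le_exp_of_le_exp_add_one_of_unit (hc : c ≠ 1) (w : PlacesOver E v) (hw : c • w.1 = w.1)
    (he : v.asIdeal.ramificationIdx' w.1.asIdeal ≠ 1) {α : w.1.adicCompletion E} (hα : Valued.v α = 1)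
    (hσα : galAdicCompletionMap (L := E) c hw α = -α) {y : w.1.adicCompletion E}
    (hσy : galAdicCompletionMap (L := E) c hw y = -y) (m : ℤ) (hy : Valued.v y ≤ WithZero.exp (2 * m + 1)) :
    Valued.v y ≤ WithZero.exp (2 * m) := by
  by_cases hy0 : y = 0
  · rw [hy0, map_zero]; exact zero_le
  · obtain ⟨k, hk⟩ := exists_valued_eq_exp_two_mul_of_galAdicCompletionMap_eq_neg_of_unit E c hc w hw he hα hσα hy0 hσy
    rw [hk, WithZero.exp_le_exp] at hy ⊢
    omega

/-- **`v_w y ≤ exp 1 ⇒ v_w y ≤ 1`** for an anti-fixed `y` at such a place: the skew fibre `{|ϖ y|_w ≤ 1}` of the `ϖ`-modular level over the torus line IS the integral skew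
line (contrast the type-odd places, where it is `q` times larger, ★ p855329 §2). [cite: SerreLocalFields1979, Ch. IV §2 Prop. 5] [cite: Jacobowitz1962, §5] -/
theorem valued_le_one_of_valued_le_exp_one_of_unit (hc : c ≠ 1) (w : PlacesOver E v) (hw : c • w.1 = w.1)
    (he : v.asIdeal.ramificationIdx' w.1.asIdeal ≠ 1) {α : w.1.adicCompletion E} (hα : Valued.v α = 1)
    (hσα : galAdicCompletionMap (L := E) c hw α = -α) {y : w.1.adicCompletion E}
    (hσy : galAdicCompletionMap (L := E) c hw y = -y) (hy : Valued.v y ≤ WithZero.exp (1 : ℤ)) : Valued.v y ≤ 1 := by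
  have h := valued_le_exp_of_le_exp_add_one_of_unit E c hc w hw he hα hσα hσy 0 (by rwa [mul_zero, zero_add])
  rwa [mul_zero, WithZero.exp_zero] at h

/-- **`v_w y < 1 ⇒ v_w y ≤ exp(−2)`** for an anti-fixed `y` at such a place: the sub-integral skew line lies one `F_v`-uniformiser deep (`|ι_w ϖ_v|_w = exp(−2)`).
[cite: SerreLocalFields1979, Ch. IV §2 Prop. 5] [cite: Jacobowitz1962, §5] -/
theorem valued_le_exp_neg_two_of_valued_lt_one_of_unit (hc : c ≠ 1) (w : PlacesOver E v) (hw : c • w.1 = w.1)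
    (he : v.asIdeal.ramificationIdx' w.1.asIdeal ≠ 1) {α : w.1.adicCompletion E} (hα : Valued.v α = 1)
    (hσα : galAdicCompletionMap (L := E) c hw α = -α) {y : w.1.adicCompletion E}
    (hσy : galAdicCompletionMap (L := E) c hw y = -y) (hy : Valued.v y < 1) : Valued.v y ≤ WithZero.exp (-2 : ℤ) := by
  -- discreteness of `ℤᵐ⁰`: `x < 1 → x ≤ exp(−1)`
  have hle : Valued.v y ≤ WithZero.exp (-1 : ℤ) := by
    rw [← WithZero.lt_mul_exp_iff_le WithZero.exp_ne_zero, ← WithZero.exp_add]; simpa using hy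
  have h := valued_le_exp_of_le_exp_add_one_of_unit E c hc w hw he hα hσα hσy (-1) (by rwa [show (2 : ℤ) * (-1) + 1 = -1 by norm_num])
  rwa [show (2 : ℤ) * (-1) = -2 by norm_num] at h

/-- **NO ANTI-FIXED UNIFORMISER** at such a place: `σ_w y = −y` ⇒ `v_w(y) ≠ exp(−1)` (even order, or `y = 0`) — the hypothesis «anti-fixed unit» and ★ p855163 §2's
«anti-fixed uniformiser» exclude each other. [cite: Jacobowitz1962, §5] [cite: SerreLocalFields1979, Ch. IV §2 Prop. 5] -/
theorem valued_ne_exp_neg_one_of_galAdicCompletionMap_eq_neg_of_unit (hc : c ≠ 1) (w : PlacesOver E v) (hw : c • w.1 = w.1)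
    (he : v.asIdeal.ramificationIdx' w.1.asIdeal ≠ 1) {α : w.1.adicCompletion E} (hα : Valued.v α = 1)
    (hσα : galAdicCompletionMap (L := E) c hw α = -α) {y : w.1.adicCompletion E}
    (hσy : galAdicCompletionMap (L := E) c hw y = -y) : Valued.v y ≠ WithZero.exp (-1 : ℤ) := by
  intro h1
  by_cases hy0 : y = 0
  · rw [hy0, map_zero] at h1; exact WithZero.zero_ne_coe h1
  · obtain ⟨k, hk⟩ := even_log_valued_of_galAdicCompletionMap_eq_neg_of_unit E c hc w hw he hα hσα hy0 hσy
    rw [h1, WithZero.log_exp] at hk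
    omega

/-! ## §3 Such a place is wild: `|2|_w < 1` -/

/-- **A PLACE WITH AN ANTI-FIXED UNIT IS WILDLY RAMIFIED: `v_w(2) < 1`** — `2α = α − σ_w α` and `σ_w ≡ id (mod 𝔪_w)` on `𝒪_w` at a ramified place (★
`valued_galAdicCompletionMap_sub_lt_one_of_ramified`), while `α` is a unit. [cite: SerreLocalFields1979, Ch. IV §2 Prop. 5] [cite: Jacobowitz1962, §5] -/
theorem valued_two_lt_one_of_unit (hc : c ≠ 1) (w : PlacesOver E v) (hw : c • w.1 = w.1)
    (he : v.asIdeal.ramificationIdx' w.1.asIdeal ≠ 1) {α : w.1.adicCompletion E} (hα : Valued.v α = 1)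
    (hσα : galAdicCompletionMap (L := E) c hw α = -α) : Valued.v (2 : w.1.adicCompletion E) < 1 := by
  have hε := valued_galAdicCompletionMap_sub_lt_one_of_ramified E c v hc w hw he α hα.le
  rw [hσα, show -α - α = -(2 * α) by ring, Valuation.map_neg, Valuation.map_mul, hα, mul_one] at hε
  exact hε

/-! ## §4 The CM rows -/

/-- **CM ROW (anti-fixed ⇒ even order, unit type)**: `L` CM, `w ∣ v` a place of `L` fixed by complex conjugation and ramified over `L⁺`, carrying a `c_w`-anti-fixed unit `α`;
every `c_w`-anti-fixed `y ≠ 0` of `L_w` has even order. [cite: SerreLocalFields1979, Ch. III §6; Ch. IV §2 Prop. 5] [cite: Jacobowitz1962, §5] -/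
theorem even_log_valued_of_complexConj_eq_neg_of_unit (L : Type) [Field L] [NumberField L] [IsCMField L]
    {v : HeightOneSpectrum (𝓞 ↥(maximalRealSubfield L))} (w : PlacesOver L v) (hw : IsCMField.complexConj L • w.1 = w.1)
    (he : v.asIdeal.ramificationIdx' w.1.asIdeal ≠ 1) {α : w.1.adicCompletion L} (hα : Valued.v α = 1)
    (hσα : galAdicCompletionMap (L := L) (IsCMField.complexConj L) hw α = -α) {y : w.1.adicCompletion L} (hy0 : y ≠ 0)
    (hσy : galAdicCompletionMap (L := L) (IsCMField.complexConj L) hw y = -y) : Even (WithZero.log (Valued.v y)) :=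
  haveI : Algebra.IsQuadraticExtension ↥(maximalRealSubfield L) L := IsCMField.isQuadraticExtension L
  even_log_valued_of_galAdicCompletionMap_eq_neg_of_unit L (IsCMField.complexConj L) (IsCMField.complexConj_ne_one L) w hw he hα hσα hy0 hσy

/-- **CM ROW (`v_w y ≤ exp 1 ⇒ v_w y ≤ 1`, unit type)**. [cite: SerreLocalFields1979, Ch. IV §2 Prop. 5] [cite: Jacobowitz1962, §5] -/
theorem valued_le_one_of_valued_le_exp_one_of_complexConj_eq_neg_of_unit (L : Type) [Field L] [NumberField L] [IsCMField L]
    {v : HeightOneSpectrum (𝓞 ↥(maximalRealSubfield L))} (w : PlacesOver L v) (hw : IsCMField.complexConj L • w.1 = w.1)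
    (he : v.asIdeal.ramificationIdx' w.1.asIdeal ≠ 1) {α : w.1.adicCompletion L} (hα : Valued.v α = 1)
    (hσα : galAdicCompletionMap (L := L) (IsCMField.complexConj L) hw α = -α) {y : w.1.adicCompletion L}
    (hσy : galAdicCompletionMap (L := L) (IsCMField.complexConj L) hw y = -y) (hy : Valued.v y ≤ WithZero.exp (1 : ℤ)) : Valued.v y ≤ 1 :=
  haveI : Algebra.IsQuadraticExtension ↥(maximalRealSubfield L) L := IsCMField.isQuadraticExtension L
  valued_le_one_of_valued_le_exp_one_of_unit L (IsCMField.complexConj L) (IsCMField.complexConj_ne_one L) w hw he hα hσα hσy hy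

/-- **CM ROW (`v_w y < 1 ⇒ v_w y ≤ exp(−2)`, unit type)**. [cite: SerreLocalFields1979, Ch. IV §2 Prop. 5] [cite: Jacobowitz1962, §5] -/
theorem valued_le_exp_neg_two_of_valued_lt_one_of_complexConj_eq_neg_of_unit (L : Type) [Field L] [NumberField L] [IsCMField L]
    {v : HeightOneSpectrum (𝓞 ↥(maximalRealSubfield L))} (w : PlacesOver L v) (hw : IsCMField.complexConj L • w.1 = w.1)
    (he : v.asIdeal.ramificationIdx' w.1.asIdeal ≠ 1) {α : w.1.adicCompletion L} (hα : Valued.v α = 1)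
    (hσα : galAdicCompletionMap (L := L) (IsCMField.complexConj L) hw α = -α) {y : w.1.adicCompletion L}
    (hσy : galAdicCompletionMap (L := L) (IsCMField.complexConj L) hw y = -y) (hy : Valued.v y < 1) : Valued.v y ≤ WithZero.exp (-2 : ℤ) :=
  haveI : Algebra.IsQuadraticExtension ↥(maximalRealSubfield L) L := IsCMField.isQuadraticExtension L
  valued_le_exp_neg_two_of_valued_lt_one_of_unit L (IsCMField.complexConj L) (IsCMField.complexConj_ne_one L) w hw he hα hσα hσy hy

/-- **CM ROW (wild)**: a ramified non-split CM place carrying an anti-fixed unit has `v_w(2) < 1`. [cite: SerreLocalFields1979, Ch. IV §2 Prop. 5] [cite: Jacobowitz1962, §5] -/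
theorem valued_two_lt_one_of_complexConj_eq_neg_of_unit (L : Type) [Field L] [NumberField L] [IsCMField L]
    {v : HeightOneSpectrum (𝓞 ↥(maximalRealSubfield L))} (w : PlacesOver L v) (hw : IsCMField.complexConj L • w.1 = w.1)
    (he : v.asIdeal.ramificationIdx' w.1.asIdeal ≠ 1) {α : w.1.adicCompletion L} (hα : Valued.v α = 1)
    (hσα : galAdicCompletionMap (L := L) (IsCMField.complexConj L) hw α = -α) : Valued.v (2 : w.1.adicCompletion L) < 1 :=
  haveI : Algebra.IsQuadraticExtension ↥(maximalRealSubfield L) L := IsCMField.isQuadraticExtension L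
  valued_two_lt_one_of_unit L (IsCMField.complexConj L) (IsCMField.complexConj_ne_one L) w hw he hα hσα

end Literature.NumberTheory.LocalFields.RamifiedPlaceAntiFixedUnitParity

end
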